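import Summits.BirchSwinnertonDyer.BirchSwinnertonDyer.Theorems.PrintCf2RubinValueTwoKatzMeasureJZeroSeamPerUnitBridge
import Summits.BirchSwinnertonDyer.BirchSwinnertonDyer.Theorems.PrintCf2RubinValueTwoEllipticUnitsGlobalUnits
import Literature.NumberTheory.EllipticCurves.DeShalitThetaTExpansionColemanBridge
import Literature.NumberTheory.EllipticCurves.DivisionPointsLaneCoherence
import Literature.NumberTheory.ComplexMultiplication.EllipticUnits.DeShalitDivisionPointsLattice
import HarnessLib

/-!
# (hβ) FOR THE ELLIPTIC UNITS `e(𝔞)` at `F = K_v`: `∃ a, g_{e(𝔞)} = (Q_R^ψ ∘ [1]_{P′,f}) ∘ [a]_f` — the `K_v`-instance of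
# `exists_unit_relColemanSeries_eq_subst_subst_of_thetaReadings` (piece (α), brick B10f-c; proofs only)

Cell `bsd-print-cf2`, width seat `bsd-line-cf2c-w4` g15.  `PerUnitBridge` (B10f-b) proves (hβ) for any local field `F` with `𝒪_F ≃ ℤ₂` and any
unit `β ∈ 𝒰_E` whose components read theta values along `ι_v : K̄ → F̄`.  This file is the one-line specialisation the seam uses:
`F := K_v`, `ι_v := absClosureEmbedding K K_v`, `β := ofGlobalUnits … (ellipticUnitsGlobal …)` — de Shalit's elliptic units
`e(𝔞) = (Θ(1; 𝔪v^{m+1}, 𝔞))_m` projected to `𝒰_E` — whose reading hypothesis is `coe_val_ofGlobalUnits` (`rfl`).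

★★★ `exists_unit_relColemanSeries_ellipticUnits_eq_subst_subst` — the hypothesis (hβ) of `KatzMeasureJZeroSeam.map_relCoatesWiles_eq_of_bridge` for
`β = ofGlobalUnits (ellipticUnitsGlobal …)`, with its `a`; remaining hypotheses as in `PerUnitBridge` ((N1) `hU`, readings, theta datum over `R`,
CM datum, `ℤ₂`-datum).  No summit statement is proved; BSD is not proved by any of this.

## References
* [deShalit1987] E. de Shalit, *Iwasawa theory of elliptic curves with complex multiplication* (1987), I §2.2 Theorem, II §4.4 (iv),
  II §4.9 (23)–(24) and Proposition (ii) (p. 62–63).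
-/

-- the summit namespace `Summit.BirchSwinnertonDyer.BirchSwinnertonDyer` repeats the problem name by design (D-0017)
set_option linter.dupNamespace false
set_option autoImplicit false

noncomputable section

open scoped Classical
open scoped NumberField
open PeriodPair Literature.NumberTheory.EllipticCurves
open Literature.NumberTheory.ComplexMultiplication.EllipticUnits
open Summit.BirchSwinnertonDyer.BirchSwinnertonDyer.Theorems.PrintCf2.EllipticUnitsLocal
open Summit.BirchSwinnertonDyer.BirchSwinnertonDyer.Theorems.PrintCf2.EllipticUnitsGlobal
open NumberField Field IsDedekindDomain IsDedekindDomain.HeightOneSpectrum ValuativeRel PowerSeries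
open Literature.NumberTheory.NumberFields
open Literature.NumberTheory.GaloisRepresentations Literature.NumberTheory.GaloisRepresentations.IsNonarchimedeanLocalField
  Literature.NumberTheory.GaloisRepresentations.LubinTate Literature.NumberTheory.EllipticCurves.FormalGroupChart _root_.WeierstrassCurve

namespace Summit.BirchSwinnertonDyer.BirchSwinnertonDyer.Theorems.PrintCf2.KatzMeasureJZeroSeam

attribute [local instance] ltNormUniformSpace ltNormIsUniformAddGroup rk1 nF nE fintypeResidueField

variable {K : Type} [Field K] [NumberField K] [IsTotallyComplex K] {𝔪 : Ideal (𝓞 K)} {v : HeightOneSpectrum (𝓞 K)}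

/-- ★★★ **(hβ) for the elliptic units at `K_v`**: `∃ a ∈ 𝒪_{K_v}ˣ, g_{e(𝔞)} = (Q_R^ψ ∘ [1]_{P′,f}) ∘ [a]_f` (de Shalit II §4.9 (ii) «`g_{e(𝔞)} = Q`»),
the `K_v`-instance of `exists_unit_relColemanSeries_eq_subst_subst_of_thetaReadings` with `β = ofGlobalUnits (ellipticUnitsGlobal …)`
(`coe_val_ofGlobalUnits`).  [cite: deShalit1987, I §2.2 Theorem, II §4.4 (iv), II §4.9 (23)–(24), Proposition (ii)] -/
theorem exists_unit_relColemanSeries_ellipticUnits_eq_subst_subst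
    -- the lane at `(v.adicCompletion K) = K_v`: `e : 𝒪_F ≃ ℤ₂`, a uniformizer `π` with `e π = π_ℤ`, the ordinary `ℤ₂`-datum of the integer model `W`
    (e : 𝒪[(v.adicCompletion K)] ≃+* ℤ_[2]) (hq : residueFieldCard (v.adicCompletion K) = 2)
    {π : 𝒪[(v.adicCompletion K)]} (hπ : (valuation (v.adicCompletion K)).IsUniformizer (π : (v.adicCompletion K)))
    {πZ : ℤ_[2]} (heπ : e π = πZ) (hA : IsLTRing πZ 2) {P : PowerSeries ℤ_[2]} (hP : IsLTSeries πZ 2 P) (W : WeierstrassCurve ℤ)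
    (hV : (W.map (Int.castRingHom ℤ_[2])).formalGroupLaw = ltF hA hP) {ϖ : ℤ_[2]} (hp : ((2 : ℕ) : ℤ_[2]) = ϖ * πZ) (hϖ : IsUnit ϖ)
    (E : IntermediateField (v.adicCompletion K) (AlgebraicClosure (v.adicCompletion K)))
    [FiniteDimensional (v.adicCompletion K) E] [Normal (v.adicCompletion K) E] [IsGalois (v.adicCompletion K) E]
    (hE : E ≤ maxUnramified (v.adicCompletion K)) {σ₀ : absoluteGaloisGroup (v.adicCompletion K)} (hσ₀ : IsAbsArithFrob σ₀)
    [hEll : ∀ m : ℕ, (curveOver (E ⊔ ltField π m : IntermediateField (v.adicCompletion K) (AlgebraicClosure (v.adicCompletion K)))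
      ((W.map (Int.castRingHom ℤ_[2])).map ((LTCoeff.of (v.adicCompletion K)).toRingHom.comp e.symm.toRingHom))).IsElliptic]
    -- the elliptic units `e(𝔞)` as a `𝒰_E`-sequence (`ofGlobalUnits ∘ ellipticUnitsGlobal`)
    (h24iii : DeShalit1987.prop24_iii_unit) (h25 : DeShalit1987.prop25_i_normRelation) (hK : IsImaginaryQuadratic K) (ι : K →+* ℂ)
    (h𝔪0 : 𝔪 ≠ ⊥) (h𝔪1 : 𝔪 ≠ ⊤) (hv : ¬ 𝔪 ≤ v.asIdeal) (hw : ∀ u : (𝓞 K)ˣ, (u : 𝓞 K) - 1 ∈ 𝔪 → u = 1)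
    {𝔞 : Ideal (𝓞 K)} (h𝔞0 : 𝔞 ≠ ⊥) (h𝔞c : IsCoprime 𝔞 (𝔪 * v.asIdeal))
    (xf : ∀ m : ℕ, rayClassField K (𝔪 * v.asIdeal ^ (m + 1)))
    (hxf : ∀ m, IsThetaValueOne ι (𝔪 * v.asIdeal ^ (m + 1)) 𝔞
      (algClosureEmb ι ((xf m : rayClassField K (𝔪 * v.asIdeal ^ (m + 1))) : AlgebraicClosure K)))
    {α𝔪 : 𝓞 K} (hα0 : α𝔪 ≠ 0) (hα𝔪 : α𝔪 - 1 ∈ 𝔪) (hαw : ∀ w : HeightOneSpectrum (𝓞 K), w ≠ v → α𝔪 ∉ w.asIdeal)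
    {f : ℕ} (hαπ : ((α𝔪 : K) : (v.adicCompletion K)) = (π : (v.adicCompletion K)) ^ f)
    (hdegE : ∀ g : WeilGroup (v.adicCompletion K),
      WeilGroup.toAbsGalois (v.adicCompletion K) g ∈ E.fixingSubgroup → (f : ℤ) ∣ WeilGroup.deg g)
    -- the split prime: `v = (π₀)`, `2 = π₀π₁`, `π₀` prime, `π₀ ∤ π₁`, `π₀ᵏ ∉ 𝔪`; `β_K π₀ ≡ 1 (mod 𝔪)`
    {π₀ π₁ βK : 𝓞 K} (hv0 : v.asIdeal = Ideal.span {π₀}) (h2K : (2 : 𝓞 K) = π₀ * π₁) (hprime : Prime π₀) (hπ₁ : ¬ π₀ ∣ π₁)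
    (hπ₀𝔪 : ∀ k : ℕ, (π₀ ^ k : 𝓞 K) ∉ 𝔪) (hβK : βK * π₀ - 1 ∈ 𝔪)
    -- the model lattice `L = Ω·ι(𝔪)` of `W ⊗ ℂ`, `L′ = 𝔞⁻¹L`, representatives `S`
    (L La : PeriodPair) (S : Finset ℂ) {Ω : ℂ} (hS : L.IsLatticeReps La S) (hLa : La.lattice = idealInvLattice ι 𝔞 L.lattice)
    (hL : ∀ z : ℂ, z ∈ L.lattice ↔ ∃ a ∈ 𝔪, z = Ω * ι (a : K)) (hΩ : Ω ≠ 0)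
    (h₂ : L.g₂ = (W.baseChange ℂ).c₄ / 12) (h₃ : L.g₃ = (W.baseChange ℂ).c₆ / 216)
    -- the theta datum over `R`, read `𝔓`-adically by `ψ` and algebraically by `j`
    {R : Type*} [CommRing R] (ψ : R →+* unitBall E) (j : R →+* AlgebraicClosure K)
    (hψj : ∀ r : R, ((((ψ r : unitBall E) : E) : AlgebraicClosure (v.adicCompletion K))) =
      (absClosureEmbedding K (v.adicCompletion K)).toRingHom (j r))
    (Kc x₀ y₀ x₁ y₁ αR : R) (x : ℂ → R) (uc : ℂ → Rˣ) (hu : ∀ c ∈ S.erase 0, (uc c : R) = x₀ - x c)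
    (hKj : algClosureEmb ι (j Kc) = L.deltaRatio La * (L.g₂ ^ 3 - 27 * L.g₃ ^ 2) ^ (S.card - 1))
    (hxj : ∀ c ∈ S.erase 0, algClosureEmb ι (j (x c)) = ℘[L] c - (W.baseChange ℂ).b₂ / 12)
    (hx₀ : algClosureEmb ι (j x₀) = ℘[L] Ω - (W.baseChange ℂ).b₂ / 12)
    (hy₀ : algClosureEmb ι (j y₀) = (℘'[L] Ω - (W.baseChange ℂ).a₁ * (℘[L] Ω - (W.baseChange ℂ).b₂ / 12) - (W.baseChange ℂ).a₃) / 2)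
    (hx₁ : algClosureEmb ι (j x₁) = ℘[L] (ι (π₀ : K) * Ω) - (W.baseChange ℂ).b₂ / 12)
    (hy₁ : algClosureEmb ι (j y₁) = (℘'[L] (ι (π₀ : K) * Ω) - (W.baseChange ℂ).a₁ * (℘[L] (ι (π₀ : K) * Ω) - (W.baseChange ℂ).b₂ / 12) -
      (W.baseChange ℂ).a₃) / 2)
    (hαj : algClosureEmb ι (j αR) = ι (π₀ : K))
    (τ : R →+* R) (hτ : ((frobUnitBall E σ₀).symm : unitBall E →+* unitBall E).comp ψ = ψ.comp τ) (hKτ : τ Kc = Kc)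
    (eι : ℂ → ℂ) (heT : ∀ c ∈ S.erase 0, eι c ∈ S.erase 0) (hinj : Set.InjOn eι (S.erase 0 : Finset ℂ))
    (hsurj : Set.SurjOn eι (S.erase 0 : Finset ℂ) (S.erase 0 : Finset ℂ)) (hxτ : ∀ c ∈ S.erase 0, τ (x c) = x (eι c))
    (hτx₀ : ∀ m : ℕ, algClosureEmb ι (j (τ^[m + 1] x₀)) = ℘[L] (ι ((βK ^ (m + 1) : 𝓞 K) : K) * Ω) - (W.baseChange ℂ).b₂ / 12)
    (hτy₀ : ∀ m : ℕ, algClosureEmb ι (j (τ^[m + 1] y₀)) = (℘'[L] (ι ((βK ^ (m + 1) : 𝓞 K) : K) * Ω) -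
      (W.baseChange ℂ).a₁ * (℘[L] (ι ((βK ^ (m + 1) : 𝓞 K) : K) * Ω) - (W.baseChange ℂ).b₂ / 12) - (W.baseChange ℂ).a₃) / 2)
    -- the formal CM action over `R`, the transformation pair and its re-centred `R`-lifts, the series identities over `R`
    {T : PowerSeries R} (hT0 : PowerSeries.constantCoeff T = 0)
    (hTP : T.map ψ = (P.map ((LTCoeff.of (v.adicCompletion K)).toRingHom.comp e.symm.toRingHom)).map
      (algebraMap (LTCoeff (v.adicCompletion K)) (unitBall E)))
    {PC QC : Polynomial ℂ}
    (hT : ∀ z : ℂ, z ∉ L.lattice → ι (π₀ : K) * z ∉ L.lattice → PC.eval (℘[L] z) = ℘[L] (ι (π₀ : K) * z) * QC.eval (℘[L] z))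
    (hQC : ∀ z : ℂ, z ∉ L.lattice → ι (π₀ : K) * z ∉ L.lattice → QC.eval (℘[L] z) ≠ 0)
    {Pr Qr : Polynomial R} {s : ℂ} (hs : s ≠ 0)
    (hQr : Qr.map ((algClosureEmb ι).comp j) = Polynomial.C s * QC.comp (Polynomial.X + Polynomial.C ((W.baseChange ℂ).b₂ / 12)))
    (hPr : Pr.map ((algClosureEmb ι).comp j) = Polynomial.C s * (PC.comp (Polynomial.X + Polynomial.C ((W.baseChange ℂ).b₂ / 12)) -
      Polynomial.C ((W.baseChange ℂ).b₂ / 12) * QC.comp (Polynomial.X + Polynomial.C ((W.baseChange ℂ).b₂ / 12))))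
    (hidX : (((W.map (Int.castRingHom R)).translateX x₁ y₁).subst T + C (0 : R)) *
        Polynomial.aeval ((W.map (Int.castRingHom R)).translateX x₀ y₀ + C (0 : R)) Qr =
      Polynomial.aeval ((W.map (Int.castRingHom R)).translateX x₀ y₀ + C (0 : R)) Pr)
    (hidY : C αR * (2 * PowerSeries.subst T ((W.map (Int.castRingHom R)).translateY x₁ y₁) +
            C (W.map (Int.castRingHom R)).a₁ * PowerSeries.subst T ((W.map (Int.castRingHom R)).translateX x₁ y₁) +
            C (W.map (Int.castRingHom R)).a₃) *
          Polynomial.aeval ((W.map (Int.castRingHom R)).translateX x₀ y₀ + C (0 : R)) Qr +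
        (PowerSeries.subst T ((W.map (Int.castRingHom R)).translateX x₁ y₁) + C (0 : R)) *
          Polynomial.aeval ((W.map (Int.castRingHom R)).translateX x₀ y₀ + C (0 : R)) (Polynomial.derivative Qr) *
          (2 * (W.map (Int.castRingHom R)).translateY x₀ y₀ +
            C (W.map (Int.castRingHom R)).a₁ * (W.map (Int.castRingHom R)).translateX x₀ y₀ + C (W.map (Int.castRingHom R)).a₃) =
      Polynomial.aeval ((W.map (Int.castRingHom R)).translateX x₀ y₀ + C (0 : R)) (Polynomial.derivative Pr) *
        (2 * (W.map (Int.castRingHom R)).translateY x₀ y₀ +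
          C (W.map (Int.castRingHom R)).a₁ * (W.map (Int.castRingHom R)).translateX x₀ y₀ + C (W.map (Int.castRingHom R)).a₃))
    -- LEVELWISE readings of `ξ(u_{m+1})`, `ξ(Ω/π₀^{m+1})` in `M_m`, of `ξ(Ω + u_{m+2})`, `ξ(π₀(Ω + u_{m+2}))` in `M_{m+1}`, through `K̄`
    (xu yu xq yq xw yw xz yz : ℕ → AlgebraicClosure K)
    (hxu : ∀ m : ℕ, algClosureEmb ι (xu m) =
      ℘[L] (ι ((βK ^ (m + 1) : 𝓞 K) : K) * Ω - Ω / ι ((π₀ ^ (m + 1) : 𝓞 K) : K)) - (W.baseChange ℂ).b₂ / 12)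
    (hyu : ∀ m : ℕ, algClosureEmb ι (yu m) = (℘'[L] (ι ((βK ^ (m + 1) : 𝓞 K) : K) * Ω - Ω / ι ((π₀ ^ (m + 1) : 𝓞 K) : K)) -
      (W.baseChange ℂ).a₁ * (℘[L] (ι ((βK ^ (m + 1) : 𝓞 K) : K) * Ω - Ω / ι ((π₀ ^ (m + 1) : 𝓞 K) : K)) - (W.baseChange ℂ).b₂ / 12) -
      (W.baseChange ℂ).a₃) / 2)
    (hxq : ∀ m : ℕ, algClosureEmb ι (xq m) = ℘[L] (Ω / ι ((π₀ ^ (m + 1) : 𝓞 K) : K)) - (W.baseChange ℂ).b₂ / 12)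
    (hyq : ∀ m : ℕ, algClosureEmb ι (yq m) = (℘'[L] (Ω / ι ((π₀ ^ (m + 1) : 𝓞 K) : K)) -
      (W.baseChange ℂ).a₁ * (℘[L] (Ω / ι ((π₀ ^ (m + 1) : 𝓞 K) : K)) - (W.baseChange ℂ).b₂ / 12) - (W.baseChange ℂ).a₃) / 2)
    (hxw : ∀ m : ℕ, algClosureEmb ι (xw m) =
      ℘[L] (Ω + (ι ((βK ^ (m + 2) : 𝓞 K) : K) * Ω - Ω / ι ((π₀ ^ (m + 2) : 𝓞 K) : K))) - (W.baseChange ℂ).b₂ / 12)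
    (hyw : ∀ m : ℕ, algClosureEmb ι (yw m) = (℘'[L] (Ω + (ι ((βK ^ (m + 2) : 𝓞 K) : K) * Ω - Ω / ι ((π₀ ^ (m + 2) : 𝓞 K) : K))) -
      (W.baseChange ℂ).a₁ * (℘[L] (Ω + (ι ((βK ^ (m + 2) : 𝓞 K) : K) * Ω - Ω / ι ((π₀ ^ (m + 2) : 𝓞 K) : K))) -
        (W.baseChange ℂ).b₂ / 12) - (W.baseChange ℂ).a₃) / 2)
    (hxz : ∀ m : ℕ, algClosureEmb ι (xz m) =
      ℘[L] (ι (π₀ : K) * (Ω + (ι ((βK ^ (m + 2) : 𝓞 K) : K) * Ω - Ω / ι ((π₀ ^ (m + 2) : 𝓞 K) : K)))) - (W.baseChange ℂ).b₂ / 12)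
    (hyz : ∀ m : ℕ, algClosureEmb ι (yz m) =
      (℘'[L] (ι (π₀ : K) * (Ω + (ι ((βK ^ (m + 2) : 𝓞 K) : K) * Ω - Ω / ι ((π₀ ^ (m + 2) : 𝓞 K) : K)))) -
        (W.baseChange ℂ).a₁ * (℘[L] (ι (π₀ : K) * (Ω + (ι ((βK ^ (m + 2) : 𝓞 K) : K) * Ω - Ω / ι ((π₀ ^ (m + 2) : 𝓞 K) : K)))) -
          (W.baseChange ℂ).b₂ / 12) - (W.baseChange ℂ).a₃) / 2)
    (XU YU XQ YQ : ∀ m : ℕ, ↥(E ⊔ ltField π m : IntermediateField (v.adicCompletion K) (AlgebraicClosure (v.adicCompletion K))))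
    (XW YW XZ YZ : ∀ m : ℕ, ↥(E ⊔ ltField π (m + 1) : IntermediateField (v.adicCompletion K) (AlgebraicClosure (v.adicCompletion K))))
    (hXU : ∀ m, ((XU m : ↥(E ⊔ ltField π m : IntermediateField (v.adicCompletion K) (AlgebraicClosure (v.adicCompletion K)))) : AlgebraicClosure (v.adicCompletion K)) =
      (absClosureEmbedding K (v.adicCompletion K)).toRingHom (xu m))
    (hYU : ∀ m, ((YU m : ↥(E ⊔ ltField π m : IntermediateField (v.adicCompletion K) (AlgebraicClosure (v.adicCompletion K)))) : AlgebraicClosure (v.adicCompletion K)) =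
      (absClosureEmbedding K (v.adicCompletion K)).toRingHom (yu m))
    (hXQ : ∀ m, ((XQ m : ↥(E ⊔ ltField π m : IntermediateField (v.adicCompletion K) (AlgebraicClosure (v.adicCompletion K)))) : AlgebraicClosure (v.adicCompletion K)) =
      (absClosureEmbedding K (v.adicCompletion K)).toRingHom (xq m))
    (hYQ : ∀ m, ((YQ m : ↥(E ⊔ ltField π m : IntermediateField (v.adicCompletion K) (AlgebraicClosure (v.adicCompletion K)))) : AlgebraicClosure (v.adicCompletion K)) =
      (absClosureEmbedding K (v.adicCompletion K)).toRingHom (yq m))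
    (hXW : ∀ m, ((XW m : ↥(E ⊔ ltField π (m + 1) : IntermediateField (v.adicCompletion K) (AlgebraicClosure (v.adicCompletion K)))) : AlgebraicClosure (v.adicCompletion K)) =
      (absClosureEmbedding K (v.adicCompletion K)).toRingHom (xw m))
    (hYW : ∀ m, ((YW m : ↥(E ⊔ ltField π (m + 1) : IntermediateField (v.adicCompletion K) (AlgebraicClosure (v.adicCompletion K)))) : AlgebraicClosure (v.adicCompletion K)) =
      (absClosureEmbedding K (v.adicCompletion K)).toRingHom (yw m))
    (hXZ : ∀ m, ((XZ m : ↥(E ⊔ ltField π (m + 1) : IntermediateField (v.adicCompletion K) (AlgebraicClosure (v.adicCompletion K)))) : AlgebraicClosure (v.adicCompletion K)) =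
      (absClosureEmbedding K (v.adicCompletion K)).toRingHom (xz m))
    (hYZ : ∀ m, ((YZ m : ↥(E ⊔ ltField π (m + 1) : IntermediateField (v.adicCompletion K) (AlgebraicClosure (v.adicCompletion K)))) : AlgebraicClosure (v.adicCompletion K)) =
      (absClosureEmbedding K (v.adicCompletion K)).toRingHom (yz m))
    -- (N1): de Shalit's division points lie in the kernel of reduction
    (hU : ∀ (m : ℕ) (h : (curveOver (E ⊔ ltField π m : IntermediateField (v.adicCompletion K) (AlgebraicClosure (v.adicCompletion K)))
        ((W.map (Int.castRingHom ℤ_[2])).map ((LTCoeff.of (v.adicCompletion K)).toRingHom.comp e.symm.toRingHom))).toAffine.Nonsingular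
        (XU m) (YU m)),
      (.some (XU m) (YU m) h : (curveOver (E ⊔ ltField π m : IntermediateField (v.adicCompletion K) (AlgebraicClosure (v.adicCompletion K)))
        ((W.map (Int.castRingHom ℤ_[2])).map ((LTCoeff.of (v.adicCompletion K)).toRingHom.comp e.symm.toRingHom))).toAffine.Point) ∈
      kernel (NormedField.valuation (K := ↥(E ⊔ ltField π m : IntermediateField (v.adicCompletion K) (AlgebraicClosure (v.adicCompletion K)))))
        (curveOver (E ⊔ ltField π m : IntermediateField (v.adicCompletion K) (AlgebraicClosure (v.adicCompletion K)))
          ((W.map (Int.castRingHom ℤ_[2])).map ((LTCoeff.of (v.adicCompletion K)).toRingHom.comp e.symm.toRingHom)))) :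
    ∃ a : 𝒪[(v.adicCompletion K)]ˣ,
      relColemanSeries hπ E hq hE hσ₀
          (RelNormCoherentUnits.ofGlobalUnits h𝔪0 hv hw hπ hα0 hα𝔪 hαw hαπ E hE hdegE
            (ellipticUnitsGlobal h24iii h25 hK ι h𝔪0 h𝔪1 hv hw h𝔞0 h𝔞c xf hxf)) =
        PowerSeries.subst ((hom (isLTRing_LTCoeff hπ) (isLTSeries_LTCoeff _) (isLTSeries_LTCoeff _)
            (LTCoeff.of (v.adicCompletion K) (a : 𝒪[(v.adicCompletion K)]))).map
            (algebraMap (LTCoeff (v.adicCompletion K)) (unitBall E)))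
          (PowerSeries.subst ((hom (isLTRing_LTCoeff hπ) (isLTSeries_map_LTCoeff_of_degree_one e hq heπ hP) (isLTSeries_LTCoeff _) 1).map
            (algebraMap (LTCoeff (v.adicCompletion K)) (unitBall E)))
            (PowerSeries.map ψ (C Kc * ∏ c ∈ S.erase 0,
              PowerSeries.invOfUnit (((W.map (Int.castRingHom R)).translateX x₀ y₀).subst (W.map (Int.castRingHom R)).formalNeg - C (x c))
                (uc c) ^ 6))) :=
  exists_unit_relColemanSeries_eq_subst_subst_of_thetaReadings e hq hπ heπ hA hP W hV hp hϖ E hE hσ₀ _ ι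
    (absClosureEmbedding K (v.adicCompletion K)).toRingHom h𝔪1 xf hxf
    (fun m => coe_val_ofGlobalUnits h𝔪0 hv hw hπ hα0 hα𝔪 hαw hαπ E hE hdegE
      (ellipticUnitsGlobal h24iii h25 hK ι h𝔪0 h𝔪1 hv hw h𝔞0 h𝔞c xf hxf) m)
    hv0 h2K hprime hπ₁ hπ₀𝔪 hβK L La S hS hLa hL hΩ h₂ h₃ ψ j hψj Kc x₀ y₀ x₁ y₁ αR x uc hu hKj hxj hx₀ hy₀ hx₁ hy₁ hαj τ hτ hKτ eι heT hinj
    hsurj hxτ hτx₀ hτy₀ hT0 hTP hT hQC hs hQr hPr hidX hidY xu yu xq yq xw yw xz yz hxu hyu hxq hyq hxw hyw hxz hyz XU YU XQ YQ XW YW XZ YZ hXU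
    hYU hXQ hYQ hXW hYW hXZ hYZ hU

end Summit.BirchSwinnertonDyer.BirchSwinnertonDyer.Theorems.PrintCf2.KatzMeasureJZeroSeam

end
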